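import Summits.CriticalPhenomena.PercolationContinuityZ3.Theorems.PercNearOneGluingNoHeavyLowerTailLemmaTPsiCert
import HarnessLib

/-!
# `NoHeavyLowerTail` (stmt-CriticalPhenomena-4575) — LEMMA T(i) without ordering the two ports

Support file (certificate seat `prim-cert-1`, gen 5; `--supports stmt-CriticalPhenomena-4575`).  No definitions, no sorries.
`LemmaTPsi.lemmaT_ordered` assumes `μ(j↔b) ≤ μ(p↔b) ≤ μ(q↔b)`; the functional `Ψ` and the hypothesis `μ(j↔b) ≤ min` are symmetric
in the two ports `p = v 3`, `q = v 4`, so relabelling by the transposition `(3 4)` gives the statement under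
`μ(j↔b) ≤ μ(p↔b)`, `μ(j↔b) ≤ μ(q↔b)` alone (`lemmaT`) — prim-lf-3's LEMMA T(i) / the lead's claim (b) of LEAD-GEN11 §3h.
[cite: VandenbergHaggstromKahn2005, Thm. 1.5 (p. 7)] [cite: KozmaNitzan2024, Question 7 (p. 36)]
-/

noncomputable section

namespace Summit.CriticalPhenomena.PercolationContinuityZ3.Theorems

open MeasureTheory Set Literature.Probability.Percolation
open Literature.Probability.LatticeModels (prodBernoulli)
open scoped Classical
open PatternCells CertCheck CertCells
open PsiZeroB (fZB fJB fABEZ fLAST set_fJB set_fZB)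

namespace LemmaTPsi

variable {n : ℕ}

/-- The port transposition `(3 4)` on terminal indices. [folklore] -/
def swapPQ : Fin 5 → Fin 5 := Equiv.swap (3 : Fin 5) 4

/-- Values of the port transposition. [folklore] -/
theorem swapPQ_vals : swapPQ 0 = 0 ∧ swapPQ 1 = 1 ∧ swapPQ 2 = 2 ∧ swapPQ 3 = 4 ∧ swapPQ 4 = 3 := by decide

/-- The port transposition is injective. [folklore] -/
theorem swapPQ_injective : Function.Injective swapPQ := (Equiv.swap (3 : Fin 5) 4).injective

/-- `{z↔b}` is invariant under the port swap. [folklore] -/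
theorem set_fZB_swap (v : Fin 5 → Fin n) : fZB.set (v ∘ swapPQ) = fZB.set v := by
  rw [set_fZB, set_fZB, Function.comp_apply, Function.comp_apply, swapPQ_vals.1, swapPQ_vals.2.1]

/-- `{j↔b}` is invariant under the port swap. [folklore] -/
theorem set_fJB_swap (v : Fin 5 → Fin n) : fJB.set (v ∘ swapPQ) = fJB.set v := by
  rw [set_fJB, set_fJB, Function.comp_apply, Function.comp_apply, swapPQ_vals.1, swapPQ_vals.2.2.1]

/-- `fABEZ` is invariant under the port swap. [folklore] -/
theorem set_fABEZ_swap (v : Fin 5 → Fin n) : fABEZ.set (v ∘ swapPQ) = fABEZ.set v := by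
  obtain ⟨h0, h1, h2, h3, h4⟩ := swapPQ_vals
  ext ω
  simp only [PsiZeroB.fABEZ, mem_set_cons, not_mem_set_nil, List.forall_mem_cons, forall_mem_nil_iff, holds_true, holds_false,
    and_true, or_false, Function.comp_apply, h0, h1, h2, h3, h4]
  tauto

/-- `fLAST` is invariant under the port swap. [folklore] -/
theorem set_fLAST_swap (v : Fin 5 → Fin n) : fLAST.set (v ∘ swapPQ) = fLAST.set v := by
  obtain ⟨h0, h1, h2, h3, h4⟩ := swapPQ_vals
  ext ω
  simp only [PsiZeroB.fLAST, mem_set_cons, not_mem_set_nil, List.forall_mem_cons, forall_mem_nil_iff, holds_true, holds_false,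
    and_true, or_false, Function.comp_apply, h0, h1, h2, h3, h4]
  tauto

/-- **LEMMA T(i)** (prim-lf-3 LF3-BETA-R §16b with `w = j`; the lead's `Ψ(0) ≥ 0`, LEAD-GEN11 §3h (b)): for every weight vector `w`
on `Fin n` and every injective placement `v` of the terminals `(b,z,j,p,q) = (v 0,…,v 4)` with `μ(j↔b) ≤ μ(p↔b)` and
`μ(j↔b) ≤ μ(q↔b)`:
  `μ(j↔b) + μ({z↔b} ∧ {p↮b} ∧ {q↮b} ∧ ({j↔p} ∨ {j↔q})) ≤ μ(z↔b) + μ(({p↔b} ∨ {q↔b}) ∧ {z ↮ b,p,q,j})`,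
i.e. `P(A↔b, E_z) − P(z↔b, A↮b, j∼A) ≥ a_j − a_z` for `A = {p,q}`. [cite: KozmaNitzan2024, Question 7 (p. 36)] -/
theorem lemmaT (w : Sym2 (Fin n) → unitInterval) (v : Fin 5 → Fin n) (hv : Function.Injective v)
    (hjp : (prodBernoulli w).real (openConn (v 2) (v 0)) ≤ (prodBernoulli w).real (openConn (v 3) (v 0)))
    (hjq : (prodBernoulli w).real (openConn (v 2) (v 0)) ≤ (prodBernoulli w).real (openConn (v 4) (v 0))) :
    (prodBernoulli w).real (fJB.set v) + (prodBernoulli w).real (fLAST.set v) ≤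
      (prodBernoulli w).real (fZB.set v) + (prodBernoulli w).real (fABEZ.set v) := by
  rcases le_total ((prodBernoulli w).real (openConn (v 3) (v 0))) ((prodBernoulli w).real (openConn (v 4) (v 0))) with hpq | hqp
  · exact lemmaT_ordered w v hv hjp hpq
  · obtain ⟨h0, h1, h2, h3, h4⟩ := swapPQ_vals
    have hv' : Function.Injective (v ∘ swapPQ) := hv.comp swapPQ_injective
    have key := lemmaT_ordered w (v ∘ swapPQ) hv'
      (by simp only [Function.comp_apply, h0, h2, h3]; exact hjq)
      (by simp only [Function.comp_apply, h0, h3, h4]; exact hqp)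
    rwa [set_fJB_swap, set_fZB_swap, set_fABEZ_swap, set_fLAST_swap] at key

/-- **LEMMA T(i), `openConn` form of the simple events** (same statement, `{j↔b}` and `{z↔b}` as `openConn`). [this file] -/
theorem lemmaT' (w : Sym2 (Fin n) → unitInterval) (v : Fin 5 → Fin n) (hv : Function.Injective v)
    (hjp : (prodBernoulli w).real (openConn (v 2) (v 0)) ≤ (prodBernoulli w).real (openConn (v 3) (v 0)))
    (hjq : (prodBernoulli w).real (openConn (v 2) (v 0)) ≤ (prodBernoulli w).real (openConn (v 4) (v 0))) :
    (prodBernoulli w).real (openConn (v 2) (v 0)) + (prodBernoulli w).real (fLAST.set v) ≤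
      (prodBernoulli w).real (openConn (v 1) (v 0)) + (prodBernoulli w).real (fABEZ.set v) := by
  have := lemmaT w v hv hjp hjq
  rwa [set_fJB, set_fZB] at this

end LemmaTPsi

end Summit.CriticalPhenomena.PercolationContinuityZ3.Theorems

end
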